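import Summits.CriticalPhenomena.PercolationContinuityZ3.Theorems.PercNearOneGluingNoHeavyLowerTailSahiAntipodalReduction
import Summits.CriticalPhenomena.PercolationContinuityZ3.Theorems.PercNearOneGluingNoHeavyLowerTailSahiBoxChain

/-!
# `NoHeavyLowerTail` (crux stmt-CriticalPhenomena-4575), P2 — **`G3`: Φ-POSITIVITY UNDER STAR ON EVERY CUBE WITH A LOG-MODULAR (PRODUCT) WEIGHT**, via the antipodal lemma on boxes

Memo SAHI-ROUTE.md §4.29(b), §4.30, §4.31 / `G3-REDUCTIONS-PROOFS.md` §§0–2, 6 (seat `prim-masterthm-p2`, gen 9; `--supports stmt-CriticalPhenomena-4575`).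
No `sorry`, standard axioms.

PART 1 — THE ANTIPODAL LEMMA `AL` ON A BOX.  On the box `2^D` (`D : Finset ι`) with the relative complement `ū = D ∖ u`, for `F ≥ 0` increasing,
a ratio `r ∈ [0,1]` with the STAR inequality `F c' ≤ (1 − r c + r c')·F c` (`c' ⊆ c`), `H ≥ 0` increasing, `Y` increasing with `F·H ≤ Y`,
and `g ≥ 0` increasing:  `Σ_{u ⊆ D} g(u)·[(2 − r u)·Y u − F(ū)·H u − (1 − r ū)·Y ū] ≥ 0`  (`antipodal_box`).
Proof.  (1) `g = 1_U`, `U` an up-set of the box (`antipodal_upset`): enumerate `U` as `c 0, c 1, …` with `t ↦ F(D ∖ c t)` non-increasing and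
`⊆`-smaller sets first (`exists_sorted_enum`); the chain lemma (`SahiBox.exists_chain_matching`) gives covers `p t ⊇ D ∖ c t` enumerating `U`
with `Σ_t F(D∖c t)·H(c t) ≤ Σ_t F(D∖c t)·H(p t)`; re-indexing the box sum along `p` and the two antipodal sums along `c`, the sum is
`≥ Σ_t margin(p t, D ∖ c t) ≥ 0` (`SahiSharedCube.margin_nonneg`).  (2) General `g` by the discrete layer-cake induction on the support of `g`
(`sum_mul_nonneg_of_upsets`).
PART 2 — `G3` (`phi_nonneg`).  Let `w` be a probability weight on the cube `Finset ι` which is LOG-MODULAR, `w(x)w(y) = w(x ∩ y)w(x ∪ y)` (every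
product Bernoulli weight is).  With `F, r, H, Y, g` as above (on the whole cube):
  `Φ := Σ_x w_x [ g_x((2 − r_x)Y_x − EF·H_x) − Eg·(1 − r_x)Y_x ] ≥ 0`,  `EF = Σ w F`, `Eg = Σ w g`.
Proof (orbit reduction, PROOFS §1).  `Φ = Σ_{x,y} w_x w_y T(x,y)` with `T(x,y) = g_x[(2−r_x)Y_x − F_yH_x − (1−r_y)Y_y]` (`phi_eq_double_sum`); by
log-modularity `w_x w_y = w_{x∩y} w_{x∪y}` is constant on the fibres of `(x,y) ↦ (x∩y, x∪y)`; the fibre over `(a,b)`, `a ⊆ b`, is the box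
`{(a ∪ u, a ∪ (D∖u)) : u ⊆ D}`, `D = b ∖ a` (`fiber_eq_image`), on which `Σ T ≥ 0` is PART 1 for the shifted functions `u ↦ g(a ∪ u)`, … .
THEOREM B (the hybrid certificate ⇒ `E_3 ≥ 0` on cubes) follows in `…SahiSharedCubeHybrid`.
-/

noncomputable section

open scoped Classical

namespace Summit.CriticalPhenomena.PercolationContinuityZ3.Theorems

namespace SahiBox

open Finset

variable {ι : Type} [DecidableEq ι]

/-! ## Sorted enumerations and re-indexing -/

/-- A finite family of sets admits an enumeration along which an `⊆`-antitone `key` is non-increasing and which lists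
`⊆`-smaller sets first among ties (so that `c t ⊆ c s → t ≤ s`). [folklore] -/
theorem exists_sorted_enum (key : Finset ι → ℝ) (hkey : ∀ u u' : Finset ι, u ⊆ u' → key u' ≤ key u) :
    ∀ (n : ℕ) (U : Finset (Finset ι)), U.card = n → ∃ c : ℕ → Finset ι,
      (∀ s < n, c s ∈ U) ∧ (∀ s t, s < n → t < n → c t ⊆ c s → t ≤ s) ∧
      (∀ s t, s ≤ t → t < n → key (c t) ≤ key (c s)) := by
  intro n
  induction n with
  | zero =>
    intro U _
    exact ⟨fun _ => ∅, fun s hs => absurd hs (Nat.not_lt_zero _), fun s t hs => absurd hs (Nat.not_lt_zero _),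
      fun s t _ ht => absurd ht (Nat.not_lt_zero _)⟩
  | succ n ih =>
    intro U hU
    have hne : U.Nonempty := by rw [← Finset.card_pos, hU]; exact Nat.succ_pos n
    obtain ⟨u₁, hu₁, hmax⟩ := Finset.exists_max_image U key hne
    have hne' : (U.filter fun u => key u = key u₁).Nonempty := ⟨u₁, by simp [hu₁]⟩
    obtain ⟨u₀, hu₀, hmin⟩ := Finset.exists_min_image _ (fun u : Finset ι => u.card) hne'
    rw [Finset.mem_filter] at hu₀
    obtain ⟨c', hc'1, hc'2, hc'3⟩ := ih (U.erase u₀) (by rw [Finset.card_erase_of_mem hu₀.1, hU]; rfl)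
    refine ⟨fun s => if s = 0 then u₀ else c' (s - 1), fun s hs => ?_, fun s t hs ht hts => ?_, fun s t hst ht => ?_⟩
    · by_cases h0 : s = 0
      · simp only [h0, if_true]; exact hu₀.1
      · simp only [h0, if_false]; exact Finset.mem_of_mem_erase (hc'1 (s - 1) (by omega))
    · by_cases ht0 : t = 0
      · omega
      by_cases hs0 : s = 0
      · exfalso
        simp only [hs0, ht0, if_true, if_false] at hts
        have hmemE := hc'1 (t - 1) (by omega)
        have hct : c' (t - 1) ∈ U := Finset.mem_of_mem_erase hmemE
        have hne0 : c' (t - 1) ≠ u₀ := Finset.ne_of_mem_erase hmemE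
        have hk : key (c' (t - 1)) = key u₁ :=
          le_antisymm (hmax _ hct) (by rw [← hu₀.2]; exact hkey _ _ hts)
        have hcard : u₀.card ≤ (c' (t - 1)).card := hmin (c' (t - 1)) (by simp [hct, hk])
        have hlt : (c' (t - 1)).card < u₀.card := Finset.card_lt_card (lt_of_le_of_ne hts hne0)
        omega
      · simp only [hs0, ht0, if_false] at hts
        have := hc'2 (s - 1) (t - 1) (by omega) (by omega) hts
        omega
    · by_cases hs0 : s = 0
      · subst hs0
        by_cases ht0 : t = 0
        · simp [ht0]
        · simp only [ht0, if_false, if_true]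
          rw [hu₀.2]
          exact hmax _ (Finset.mem_of_mem_erase (hc'1 (t - 1) (by omega)))
      · have ht0 : t ≠ 0 := by omega
        simp only [hs0, ht0, if_false]
        exact hc'3 (s - 1) (t - 1) (by omega) (by omega)

/-- Re-indexing a sum over `U` along an injective enumeration of `U`. [folklore] -/
theorem sum_eq_sum_range_of_enum {U : Finset (Finset ι)} {m : ℕ} {p : ℕ → Finset ι} (hmem : ∀ t < m, p t ∈ U)
    (hinj : ∀ s t, s < m → t < m → p s = p t → s = t) (hcard : U.card = m) (φ : Finset ι → ℝ) :
    ∑ u ∈ U, φ u = ∑ t ∈ Finset.range m, φ (p t) := by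
  have hinj' : ∀ s ∈ Finset.range m, ∀ t ∈ Finset.range m, p s = p t → s = t := fun s hs t ht h =>
    hinj s t (Finset.mem_range.1 hs) (Finset.mem_range.1 ht) h
  have himg : (Finset.range m).image p = U := by
    apply Finset.eq_of_subset_of_card_le
    · intro u hu
      obtain ⟨t, ht, rfl⟩ := Finset.mem_image.1 hu
      exact hmem t (Finset.mem_range.1 ht)
    · rw [Finset.card_image_of_injOn hinj', Finset.card_range, hcard]
  rw [← himg, Finset.sum_image hinj']

/-! ## `AL` for the indicator of an up-set of the box -/

/-- **`AL` for `g = 1_U`** (`U` an up-set of the box `2^D`):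
`Σ_{u∈U} [(2 − r u)Y u − F(D∖u)H u − (1 − r(D∖u))Y(D∖u)] ≥ 0`. [this work] -/
theorem antipodal_upset (D : Finset ι) {U : Finset (Finset ι)} (hUD : ∀ x ∈ U, x ⊆ D)
    (hup : ∀ ⦃x y : Finset ι⦄, x ∈ U → x ⊆ y → y ⊆ D → y ∈ U)
    {F H Y r : Finset ι → ℝ} (hF : Monotone F) (hF0 : ∀ c, 0 ≤ F c) (hH : Monotone H) (hH0 : ∀ c, 0 ≤ H c)
    (hY : Monotone Y) (hFH : ∀ c, F c * H c ≤ Y c) (hr0 : ∀ c, 0 ≤ r c) (hr1 : ∀ c, r c ≤ 1)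
    (hstar : ∀ c c', c' ≤ c → F c' ≤ (1 - r c + r c') * F c) :
    0 ≤ ∑ u ∈ U, ((2 - r u) * Y u - F (D \ u) * H u - (1 - r (D \ u)) * Y (D \ u)) := by
  obtain ⟨c, hcmem, hclin, hckey⟩ := exists_sorted_enum (fun u => F (D \ u))
    (fun u u' huu' => hF (Finset.sdiff_subset_sdiff le_rfl huu')) U.card U rfl
  obtain ⟨p, hpmem, hpcov, hpinj, hpsum⟩ := exists_chain_matching hUD hup hcmem hclin
  have hcinj : ∀ s t, s < U.card → t < U.card → c s = c t → s = t := fun s t hs ht h =>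
    le_antisymm (hclin t s ht hs (by rw [h])) (hclin s t hs ht (by rw [h]))
  have e1 := sum_eq_sum_range_of_enum hpmem hpinj rfl
    (fun u => (2 - r u) * Y u - F (D \ u) * H u - (1 - r (D \ u)) * Y (D \ u))
  have e2 : ∑ t ∈ Finset.range U.card, F (D \ p t) * H (p t) = ∑ t ∈ Finset.range U.card, F (D \ c t) * H (c t) := by
    rw [← sum_eq_sum_range_of_enum hpmem hpinj rfl (fun u => F (D \ u) * H u),
      sum_eq_sum_range_of_enum hcmem hcinj rfl (fun u => F (D \ u) * H u)]
  have e3 : ∑ t ∈ Finset.range U.card, (1 - r (D \ p t)) * Y (D \ p t) =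
      ∑ t ∈ Finset.range U.card, (1 - r (D \ c t)) * Y (D \ c t) := by
    rw [← sum_eq_sum_range_of_enum hpmem hpinj rfl (fun u => (1 - r (D \ u)) * Y (D \ u)),
      sum_eq_sum_range_of_enum hcmem hcinj rfl (fun u => (1 - r (D \ u)) * Y (D \ u))]
  have h4 : ∑ t ∈ Finset.range U.card, F (D \ c t) * H (c t) ≤ ∑ t ∈ Finset.range U.card, F (D \ c t) * H (p t) :=
    hpsum H hH (fun t => F (D \ c t)) hckey (fun t _ => hF0 _)
  have h5 : 0 ≤ ∑ t ∈ Finset.range U.card, SahiSharedCube.margin F H Y r (p t) (D \ c t) :=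
    Finset.sum_nonneg fun t ht =>
      SahiSharedCube.margin_nonneg hY hH0 hFH hr0 hr1 hstar (hpcov t (Finset.mem_range.1 ht))
  have hsplit : ∑ t ∈ Finset.range U.card,
      ((2 - r (p t)) * Y (p t) - F (D \ p t) * H (p t) - (1 - r (D \ p t)) * Y (D \ p t)) =
      ∑ t ∈ Finset.range U.card, (2 - r (p t)) * Y (p t) - ∑ t ∈ Finset.range U.card, F (D \ p t) * H (p t) -
        ∑ t ∈ Finset.range U.card, (1 - r (D \ p t)) * Y (D \ p t) := by
    rw [Finset.sum_sub_distrib, Finset.sum_sub_distrib]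
  have hm : ∑ t ∈ Finset.range U.card, SahiSharedCube.margin F H Y r (p t) (D \ c t) =
      ∑ t ∈ Finset.range U.card, (2 - r (p t)) * Y (p t) - ∑ t ∈ Finset.range U.card, (1 - r (D \ c t)) * Y (D \ c t) -
        ∑ t ∈ Finset.range U.card, F (D \ c t) * H (p t) := by
    unfold SahiSharedCube.margin
    rw [Finset.sum_sub_distrib, Finset.sum_sub_distrib]
  rw [e1, hsplit, e2, e3]
  linarith

/-! ## Layer cake: from up-sets to increasing `g ≥ 0` -/

/-- **Discrete layer cake.**  If `Σ_{u∈U} K u ≥ 0` for every up-set `U` of the finite family `A`, then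
`Σ_{u∈A} g u · K u ≥ 0` for every `g ≥ 0` increasing on `A` (induction on the support of `g`). [folklore] -/
theorem sum_mul_nonneg_of_upsets (A : Finset (Finset ι)) (K : Finset ι → ℝ)
    (hK : ∀ U : Finset (Finset ι), U ⊆ A → (∀ ⦃x y : Finset ι⦄, x ∈ U → x ⊆ y → y ∈ A → y ∈ U) →
      0 ≤ ∑ u ∈ U, K u) :
    ∀ (n : ℕ) (g : Finset ι → ℝ), (A.filter fun u => g u ≠ 0).card ≤ n → (∀ u ∈ A, 0 ≤ g u) →
      (∀ x ∈ A, ∀ y ∈ A, x ⊆ y → g x ≤ g y) → 0 ≤ ∑ u ∈ A, g u * K u := by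
  intro n
  induction n with
  | zero =>
    intro g hg _ _
    have hz : ∀ u ∈ A, g u = 0 := fun u hu => by
      by_contra hne
      have hmem : u ∈ A.filter (fun u => g u ≠ 0) := Finset.mem_filter.2 ⟨hu, hne⟩
      rw [Nat.le_zero, Finset.card_eq_zero] at hg
      rw [hg] at hmem
      exact absurd hmem (Finset.notMem_empty u)
    rw [Finset.sum_eq_zero (fun u hu => by rw [hz u hu, zero_mul])]
  | succ n ih =>
    intro g hg hg0 hmono
    by_cases hall : ∀ u ∈ A, g u = 0
    · rw [Finset.sum_eq_zero (fun u hu => by rw [hall u hu, zero_mul])]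
    push Not at hall
    set S := A.filter (fun u => g u ≠ 0) with hS
    have hSA : S ⊆ A := Finset.filter_subset _ _
    have hSne : S.Nonempty := by
      obtain ⟨u, hu, hne⟩ := hall
      exact ⟨u, Finset.mem_filter.2 ⟨hu, hne⟩⟩
    obtain ⟨u₀, hu₀S, hmin⟩ := Finset.exists_min_image S g hSne
    have hu₀A : u₀ ∈ A := (Finset.mem_filter.1 hu₀S).1
    have hθ0 : 0 < g u₀ := lt_of_le_of_ne (hg0 u₀ hu₀A) (Ne.symm (Finset.mem_filter.1 hu₀S).2)
    -- `S` is an up-set of `A`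
    have hSup : ∀ ⦃x y : Finset ι⦄, x ∈ S → x ⊆ y → y ∈ A → y ∈ S := by
      intro x y hx hxy hyA
      have hxA : x ∈ A := (Finset.mem_filter.1 hx).1
      have hgx : 0 < g x := lt_of_le_of_ne (hg0 x hxA) (Ne.symm (Finset.mem_filter.1 hx).2)
      exact Finset.mem_filter.2 ⟨hyA, ne_of_gt (lt_of_lt_of_le hgx (hmono x hxA y hyA hxy))⟩
    -- peel off the bottom layer
    set g' : Finset ι → ℝ := fun u => if u ∈ S then g u - g u₀ else g u with hg'
    have hpt : ∀ u ∈ A, g u * K u = g u₀ * (if u ∈ S then K u else 0) + g' u * K u := by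
      intro u _
      by_cases huS : u ∈ S
      · simp only [hg', huS, if_true]; ring
      · simp only [hg', huS, if_false]; ring
    rw [Finset.sum_congr rfl hpt, Finset.sum_add_distrib, ← Finset.mul_sum, ← Finset.sum_filter,
      Finset.filter_mem_eq_inter, Finset.inter_eq_right.2 hSA]
    have h1 : 0 ≤ g u₀ * ∑ u ∈ S, K u := mul_nonneg hθ0.le (hK S hSA hSup)
    have h2 : 0 ≤ ∑ u ∈ A, g' u * K u := by
      refine ih g' ?_ ?_ ?_
      · -- the support of `g'` lies in `S.erase u₀`
        have hsub : (A.filter fun u => g' u ≠ 0) ⊆ S.erase u₀ := by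
          intro u hu
          rw [Finset.mem_filter] at hu
          rw [Finset.mem_erase]
          by_cases huS : u ∈ S
          · refine ⟨fun h => hu.2 ?_, huS⟩
            simp only [hg', h, hu₀S, if_true, sub_self]
          · exfalso
            have : g u = 0 := by
              by_contra hne
              exact huS (Finset.mem_filter.2 ⟨hu.1, hne⟩)
            exact hu.2 (by simp only [hg', huS, if_false, this])
        have := Finset.card_le_card hsub
        rw [Finset.card_erase_of_mem hu₀S] at this
        omega
      · intro u huA
        by_cases huS : u ∈ S
        · simp only [hg', huS, if_true, sub_nonneg]
          exact hmin u huS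
        · simp only [hg', huS, if_false]
          exact hg0 u huA
      · intro x hxA y hyA hxy
        by_cases hxS : x ∈ S
        · have hyS : y ∈ S := hSup hxS hxy hyA
          simp only [hg', hxS, hyS, if_true, sub_le_sub_iff_right]
          exact hmono x hxA y hyA hxy
        · have hgx : g x = 0 := by
            by_contra hne
            exact hxS (Finset.mem_filter.2 ⟨hxA, hne⟩)
          simp only [hg', hxS, if_false, hgx]
          by_cases hyS : y ∈ S
          · simp only [hyS, if_true, sub_nonneg]; exact hmin y hyS
          · simp only [hyS, if_false]; exact hg0 y hyA
    exact add_nonneg h1 h2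

/-! ## `AL` on the box -/

/-- **THE ANTIPODAL LEMMA `AL` ON A BOX.**  On `2^D` with relative complement `D ∖ u`: for `F ≥ 0` increasing, `r ∈ [0,1]` with
STAR, `H ≥ 0` increasing, `Y` increasing with `F·H ≤ Y`, and `g ≥ 0` increasing,
`Σ_{u ⊆ D} g u · [(2 − r u)·Y u − F(D∖u)·H u − (1 − r(D∖u))·Y(D∖u)] ≥ 0`. [this work] -/
theorem antipodal_box (D : Finset ι) {F H Y r g : Finset ι → ℝ} (hF : Monotone F) (hF0 : ∀ c, 0 ≤ F c)
    (hH : Monotone H) (hH0 : ∀ c, 0 ≤ H c) (hY : Monotone Y) (hFH : ∀ c, F c * H c ≤ Y c)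
    (hr0 : ∀ c, 0 ≤ r c) (hr1 : ∀ c, r c ≤ 1) (hstar : ∀ c c', c' ≤ c → F c' ≤ (1 - r c + r c') * F c)
    (hg0 : ∀ c, 0 ≤ g c) (hg : Monotone g) :
    0 ≤ ∑ u ∈ D.powerset, g u * ((2 - r u) * Y u - F (D \ u) * H u - (1 - r (D \ u)) * Y (D \ u)) :=
  sum_mul_nonneg_of_upsets D.powerset _
    (fun _ hUA hup => antipodal_upset D (fun _ hx => Finset.mem_powerset.1 (hUA hx))
      (fun _ _ hx hxy hyD => hup hx hxy (Finset.mem_powerset.2 hyD)) hF hF0 hH hH0 hY hFH hr0 hr1 hstar)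
    _ g le_rfl (fun u _ => hg0 u) (fun _ _ _ _ hxy => hg hxy)

/-! ## `G3` on the cube `Finset ι` -/

section Cube

variable [Fintype ι]

omit [DecidableEq ι] in
/-- The pair kernel `T(x,y) = g_x[(2−r_x)Y_x − F_yH_x − (1−r_y)Y_y]` summed against `w ⊗ w` is `Φ` (uses `Σ w = 1`). [this work] -/
theorem phi_eq_double_sum (w F H Y r g : Finset ι → ℝ) (hw1 : ∑ x, w x = 1) :
    ∑ x, w x * (g x * ((2 - r x) * Y x - (∑ y, w y * F y) * H x) - (∑ y, w y * g y) * ((1 - r x) * Y x)) =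
      ∑ x, ∑ y, w x * w y * (g x * ((2 - r x) * Y x - F y * H x - (1 - r y) * Y y)) := by
  have hin : ∀ x, ∑ y, w x * w y * (g x * ((2 - r x) * Y x - F y * H x - (1 - r y) * Y y)) =
      w x * g x * ((2 - r x) * Y x) * (∑ y, w y) - w x * g x * H x * (∑ y, w y * F y) -
        w x * g x * ∑ y, w y * ((1 - r y) * Y y) := by
    intro x
    rw [Finset.mul_sum, Finset.mul_sum, Finset.mul_sum, ← Finset.sum_sub_distrib, ← Finset.sum_sub_distrib]
    exact Finset.sum_congr rfl fun y _ => by ring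
  have eR : ∑ x, (w x * g x * ((2 - r x) * Y x) * (∑ y, w y) - w x * g x * H x * (∑ y, w y * F y) -
      w x * g x * ∑ y, w y * ((1 - r y) * Y y)) =
      (∑ x, w x * g x * ((2 - r x) * Y x)) * (∑ y, w y) - (∑ x, w x * g x * H x) * (∑ y, w y * F y) -
        (∑ x, w x * g x) * ∑ y, w y * ((1 - r y) * Y y) := by
    rw [Finset.sum_sub_distrib, Finset.sum_sub_distrib, ← Finset.sum_mul, ← Finset.sum_mul, ← Finset.sum_mul]
  have eL : ∑ x, w x * (g x * ((2 - r x) * Y x - (∑ y, w y * F y) * H x) - (∑ y, w y * g y) * ((1 - r x) * Y x)) =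
      (∑ x, w x * g x * ((2 - r x) * Y x)) - (∑ y, w y * F y) * (∑ x, w x * g x * H x) -
        (∑ y, w y * g y) * ∑ x, w x * ((1 - r x) * Y x) := by
    rw [Finset.mul_sum, Finset.mul_sum, ← Finset.sum_sub_distrib, ← Finset.sum_sub_distrib]
    exact Finset.sum_congr rfl fun x _ => by ring
  rw [eL, Finset.sum_congr rfl (fun x _ => hin x), eR, hw1]
  ring

/-- The fibre of `(x,y) ↦ (x ∩ y, x ∪ y)` over `(a,b)` with `a ⊆ b` is the box `{(a ∪ u, a ∪ ((b∖a)∖u)) : u ⊆ b ∖ a}`. [this work] -/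
theorem fiber_eq_image (a b : Finset ι) (hab : a ⊆ b) :
    ((Finset.univ : Finset (Finset ι × Finset ι)).filter fun p => p.1 ∩ p.2 = a ∧ p.1 ∪ p.2 = b) =
      ((b \ a).powerset).image fun u => (a ∪ u, a ∪ ((b \ a) \ u)) := by
  ext ⟨x, y⟩
  simp only [Finset.mem_filter, Finset.mem_univ, true_and, Finset.mem_image, Finset.mem_powerset, Prod.mk.injEq]
  constructor
  · rintro ⟨hxy, hxy'⟩
    refine ⟨x \ a, ?_, ?_, ?_⟩
    · intro i hi
      rw [Finset.mem_sdiff] at hi ⊢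
      exact ⟨hxy' ▸ Finset.mem_union_left y hi.1, hi.2⟩
    · rw [Finset.union_sdiff_of_subset (hxy ▸ Finset.inter_subset_left)]
    · ext i
      have h1 := Finset.ext_iff.1 hxy i
      have h2 := Finset.ext_iff.1 hxy' i
      simp only [Finset.mem_inter, Finset.mem_union, Finset.mem_sdiff] at h1 h2 ⊢
      tauto
  · rintro ⟨u, hu, rfl, rfl⟩
    constructor
    · ext i
      have hu' := fun (h : i ∈ u) => Finset.mem_sdiff.1 (hu h)
      simp only [Finset.mem_inter, Finset.mem_union, Finset.mem_sdiff]
      tauto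
    · ext i
      have hu' := fun (h : i ∈ u) => Finset.mem_sdiff.1 (hu h)
      have hab' := fun (h : i ∈ a) => hab h
      simp only [Finset.mem_union, Finset.mem_sdiff]
      tauto

/-- On each fibre the pair kernel sums to a nonnegative number (the antipodal lemma on the box `b ∖ a`). [this work] -/
theorem fiber_sum_nonneg {F H Y r g : Finset ι → ℝ} (hF : Monotone F) (hF0 : ∀ c, 0 ≤ F c)
    (hH : Monotone H) (hH0 : ∀ c, 0 ≤ H c) (hY : Monotone Y) (hFH : ∀ c, F c * H c ≤ Y c)
    (hr0 : ∀ c, 0 ≤ r c) (hr1 : ∀ c, r c ≤ 1) (hstar : ∀ c c', c' ≤ c → F c' ≤ (1 - r c + r c') * F c)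
    (hg0 : ∀ c, 0 ≤ g c) (hg : Monotone g) (a b : Finset ι) :
    0 ≤ ∑ p ∈ (Finset.univ : Finset (Finset ι × Finset ι)).filter (fun p => p.1 ∩ p.2 = a ∧ p.1 ∪ p.2 = b),
      g p.1 * ((2 - r p.1) * Y p.1 - F p.2 * H p.1 - (1 - r p.2) * Y p.2) := by
  by_cases hab : a ⊆ b
  · rw [fiber_eq_image a b hab, Finset.sum_image]
    · -- the antipodal lemma on the box `D = b \ a` for the shifted functions
      have hmono : ∀ {φ : Finset ι → ℝ}, Monotone φ → Monotone fun u : Finset ι => φ (a ∪ u) :=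
        fun hφ u u' huu' => hφ (Finset.union_subset_union (le_refl a) huu')
      have key := antipodal_box (b \ a) (F := fun u => F (a ∪ u)) (H := fun u => H (a ∪ u)) (Y := fun u => Y (a ∪ u))
        (r := fun u => r (a ∪ u)) (g := fun u => g (a ∪ u)) (hmono hF) (fun c => hF0 _) (hmono hH) (fun c => hH0 _)
        (hmono hY) (fun c => hFH _) (fun c => hr0 _) (fun c => hr1 _)
        (fun c c' hcc => hstar (a ∪ c) (a ∪ c') (Finset.union_subset_union (le_refl a) hcc)) (fun c => hg0 _) (hmono hg)
      simpa using key
    · intro u hu u' hu' h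
      have hu : u ⊆ b \ a := Finset.mem_powerset.1 hu
      have hu' : u' ⊆ b \ a := Finset.mem_powerset.1 hu'
      have h1 : a ∪ u = a ∪ u' := (Prod.mk.injEq _ _ _ _ ▸ h).1
      have hd : Disjoint a u := Finset.disjoint_left.2 fun i hia hiu => (Finset.mem_sdiff.1 (hu hiu)).2 hia
      have hd' : Disjoint a u' := Finset.disjoint_left.2 fun i hia hiu => (Finset.mem_sdiff.1 (hu' hiu)).2 hia
      calc u = (a ∪ u) \ a := (Finset.union_sdiff_cancel_left hd).symm
        _ = (a ∪ u') \ a := by rw [h1]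
        _ = u' := Finset.union_sdiff_cancel_left hd'
  · have hempty : ((Finset.univ : Finset (Finset ι × Finset ι)).filter
        fun p => p.1 ∩ p.2 = a ∧ p.1 ∪ p.2 = b) = ∅ := by
      refine Finset.filter_eq_empty_iff.2 fun p _ hp => hab ?_
      rw [← hp.1, ← hp.2]
      exact Finset.inter_subset_left.trans Finset.subset_union_left
    rw [hempty, Finset.sum_empty]

/-- **`G3` — Φ-POSITIVITY UNDER STAR on a cube with a log-modular probability weight.**  For `w ≥ 0`, `Σ w = 1`,
`w(x)w(y) = w(x∩y)w(x∪y)`; `F ≥ 0` increasing; `r ∈ [0,1]` with STAR `F c' ≤ (1 − r c + r c')F c` (`c' ⊆ c`); `H ≥ 0`, `Y`, `g ≥ 0`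
increasing with `F·H ≤ Y`:
`Σ_x w_x [ g_x((2 − r_x)Y_x − EF·H_x) − Eg·(1 − r_x)Y_x ] ≥ 0`. [this work] -/
theorem phi_nonneg (w : Finset ι → ℝ) (hw0 : ∀ x, 0 ≤ w x) (hw1 : ∑ x, w x = 1)
    (hwmod : ∀ x y, w x * w y = w (x ∩ y) * w (x ∪ y))
    {F H Y r g : Finset ι → ℝ} (hF : Monotone F) (hF0 : ∀ c, 0 ≤ F c)
    (hH : Monotone H) (hH0 : ∀ c, 0 ≤ H c) (hY : Monotone Y) (hFH : ∀ c, F c * H c ≤ Y c)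
    (hr0 : ∀ c, 0 ≤ r c) (hr1 : ∀ c, r c ≤ 1) (hstar : ∀ c c', c' ≤ c → F c' ≤ (1 - r c + r c') * F c)
    (hg0 : ∀ c, 0 ≤ g c) (hg : Monotone g) :
    0 ≤ ∑ x, w x * (g x * ((2 - r x) * Y x - (∑ y, w y * F y) * H x) - (∑ y, w y * g y) * ((1 - r x) * Y x)) := by
  rw [phi_eq_double_sum w F H Y r g hw1, ← Finset.sum_product', Finset.univ_product_univ]
  -- regroup the double sum along the fibres of `(x, y) ↦ (x ∩ y, x ∪ y)`
  rw [← Finset.sum_fiberwise_of_maps_to (s := (Finset.univ : Finset (Finset ι × Finset ι))) (t := Finset.univ)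
    (g := fun p : Finset ι × Finset ι => (p.1 ∩ p.2, p.1 ∪ p.2)) (fun p _ => Finset.mem_univ _)]
  refine Finset.sum_nonneg fun q _ => ?_
  -- on the fibre over `q = (a, b)` the weight is the constant `w a * w b ≥ 0`
  have hconst : ∀ p ∈ (Finset.univ : Finset (Finset ι × Finset ι)).filter (fun p => (p.1 ∩ p.2, p.1 ∪ p.2) = q),
      w p.1 * w p.2 * (g p.1 * ((2 - r p.1) * Y p.1 - F p.2 * H p.1 - (1 - r p.2) * Y p.2)) =
        w q.1 * w q.2 * (g p.1 * ((2 - r p.1) * Y p.1 - F p.2 * H p.1 - (1 - r p.2) * Y p.2)) := by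
    intro p hp
    have hq := (Finset.mem_filter.1 hp).2
    rw [hwmod p.1 p.2, ← hq]
  rw [Finset.sum_congr rfl hconst, ← Finset.mul_sum]
  refine mul_nonneg (mul_nonneg (hw0 _) (hw0 _)) ?_
  have hfilt : ((Finset.univ : Finset (Finset ι × Finset ι)).filter fun p => (p.1 ∩ p.2, p.1 ∪ p.2) = q) =
      (Finset.univ : Finset (Finset ι × Finset ι)).filter fun p => p.1 ∩ p.2 = q.1 ∧ p.1 ∪ p.2 = q.2 := by
    ext p
    simp only [Finset.mem_filter, Finset.mem_univ, true_and, Prod.ext_iff]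
  rw [hfilt]
  exact fiber_sum_nonneg hF hF0 hH hH0 hY hFH hr0 hr1 hstar hg0 hg q.1 q.2

end Cube

end SahiBox

end Summit.CriticalPhenomena.PercolationContinuityZ3.Theorems
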